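import Literature.NumberTheory.Automorphic.LangQuasiSplit
import Literature.NumberTheory.Automorphic.ZariskiGLProducts
import Literature.NumberTheory.Automorphic.Sweep2Proofs
import Literature.NumberTheory.Automorphic.BorelConjugacy
import Literature.RingTheory.KrullDimension.AffineDimension
import HarnessLib

/-!
# Lang's theorem: the Lang map `g ↦ g⁻¹ F(g)` is onto (discharge of `lang_map_surjective`)

Namespace `Literature.NumberTheory.Automorphic`, in the concrete `K`-points vocabulary of
`LinearAlgebraicGroups.lean` / `ZariskiGL.lean` (an algebraic group is a subgroup `G ≤ GL n K`
cut out by polynomials in the coordinates `x i j, det⁻¹`; `IsZConnected`; the local Zariski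
topologies `zariskiTopologyGL`, `zariskiTopologyPi`) and of `LangQuasiSplit.lean` (the
`q`-Frobenius `frobGL k K n : (g i j) ↦ (g i j ^ q)` of `GL n K` for a finite field `k` with `q`
elements and `K ⊇ k`). This file **discharges the named fact**
`Literature.NumberTheory.Automorphic.lang_map_surjective k K n` of `LangQuasiSplit.lean` (D-0014:
the fact stays a `def`, users feed `lang_map_surjective_holds`):

* `lang_map_surjective_holds` — **Lang's theorem** (Springer, *Linear Algebraic Groups*, 2nd ed.,
  Thm. 4.4.17 [Lang's theorem]: *"Assume `G` to be connected. Then `Λx = (σx)x⁻¹` defines a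
  surjective morphism of `G`"*, `σ` the Frobenius morphism, PDF p. 81; Lang, *Amer. J. Math.* 78
  (1956); Steinberg, Mem. AMS 80 (1968), Thm. 10.1 and Malle–Testerman Thm. 21.7, the
  Lang–Steinberg theorem, of which this is the case of a standard Frobenius map; Serre,
  *Algebraic Groups and Class Fields* VI §1 no. 4 Prop. 3, the printed form `x ↦ x⁻¹Fx` of the
  vendored fact): for `k` finite, `K ⊇ k` algebraically closed and `G ≤ GL n K` Zariski-connected,
  closed and defined over `k`, every `x ∈ G` is `g⁻¹ F(g)` with `g ∈ G`.
* `isQuasiSplitOver_of_finite_of_isBorelIn_conj` — consequently the named fact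
  `isQuasiSplitOver_of_finite k K n` of `Sweep2.lean` (a connected `k`-group over a finite field
  has a Borel subgroup defined over `k`; Lang 1956, Borel 16.6, Springer 16.2.9 (2)) is reduced to
  the conjugacy of Borel subgroups (`isBorelIn_conj`, Springer 6.2.7 (iii)), through
  `isQuasiSplitOver_of_finite_of_facts` (`LangQuasiSplit.lean`) and the discharged
  `isQuasiSplitOver_self_holds` (`Sweep2Proofs.lean`);
* `isQuasiSplitOver_of_finite_holds` — and since that conjugacy is proved in the tree
  (`isBorelIn_conj_holds`, `BorelConjugacy.lean`), this **discharges the named fact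
  `isQuasiSplitOver_of_finite`** of `Sweep2.lean` (**lang.S12**, Lang's theorem on Borel
  subgroups over finite fields: Lang 1956; Borel, *Linear Algebraic Groups* 16.6; Springer
  16.2.9 (2); Malle–Testerman Thm. 21.11 (a) with Cor. 21.12).

## The proof

As printed in Springer 4.4.17 (`exists_inv_mul_frobGL_eq`): for `x ∈ G` the images of `G` under
the Lang maps `ψ₁ : g ↦ g⁻¹ F(g)` and `ψₓ : g ↦ g⁻¹ x F(g)` each contain a non-empty open subset of
the irreducible variety `G` (`IsZConnected.isIrreducible`, Springer 2.2.1 (i)); two such sets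
meet, and `a⁻¹ F(a) = b⁻¹ x F(b)` gives `x = (a b⁻¹)⁻¹ F(a b⁻¹)`. The open subsets come from
Chevalley's theorem (Springer 1.9.5, the tree's
`exists_isOpen_inter_closure_image_subset_of_isIrreducible` of `ZariskiAffineSpace.lean`, read
through the closed embedding `glCoordFun` as in `AlgebraicHomImages.lean`) once `ψₓ(G)` is known
to be **dense** in `G` (`exists_isOpen_inter_subset_image_langMap`). Springer obtains density from
`dψ = -1` (tangent spaces); here it is obtained without differentials, from **finiteness of the
Lang map** (an integrality argument; compare Lang's original function-field proof, *loc. cit.*,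
and P. Müller's short proof, *Proc. AMS* 131 (2003)): by `F(g) = x⁻¹ g ψₓ(g)` every coordinate
function `u_c` of `G` satisfies `u_c ^ q = ∑_{c'} M_{cc'} u_{c'}` with `M_{cc'}` in the image `C` of
the comorphism `θ = ψₓ^*` on `K[G] = K[X] ⧸ 𝓘(G)` (`moduleFinite_range_comorph_langMap`), so the
`q ^ (n² + 1)` monomials of exponents `< q` span `K[G]` over `C` (`moduleFinite_of_pow_mem_span`,
induction on the degree); hence `K[G]` is integral over `C ≅ K[X] ⧸ ker θ = K[X] ⧸ 𝓘(ψₓ G)` and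
both have the same Krull dimension (going-up / incomparability,
`Literature.RingTheory.KrullDimension.ringKrullDim_eq_of_isIntegral`), which for the affine
domain `K[G]` forces `𝓘(ψₓ G) = 𝓘(G)` (`ker_eq_of_moduleFinite_range`,
`vanishingIdeal_image_eq_of_moduleFinite`: a non-zero prime of `K[G]` drops the dimension,
`ringKrullDim_quotient_add_one_le`). `F(G) = G` for a closed `k`-subgroup is
`map_frobGL_eq_of_isDefinedOver` (`LangQuasiSplit.lean`).

## Tree / Mathlib search

Reused, not restated: `frobGL`, `qFrobenius(_apply)`, `glCoordFun_map`, `frobGL_apply_apply`,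
`map_frobGL_eq_of_isDefinedOver`, `lang_map_surjective`, `isQuasiSplitOver_of_facts`
(`LangQuasiSplit`); `IsPolyMapGL` (`.mul`, `.inv`, `isPolyMapGL_id`, `isPolyMapGL_const`),
`isClosed_zariski_iff`, `IsZConnected.isIrreducible`, `IsZConnected.isPrime_vanishingIdeal`
(`ZariskiGL`); `isClosedEmbedding_glCoordFun`, `continuous_glCoordFun`,
`isIrreducible_image_glCoordFun` (`ZariskiGLProducts`);
`exists_isOpen_inter_closure_image_subset_of_isIrreducible` (`ZariskiAffineSpace`);
`mem_vanishingIdeal_glCoordFun_iff` (`IdentityComponent`); `isQuasiSplitOver_self_holds`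
(`Sweep2Proofs`); `isBorelIn_conj_holds` (`BorelConjugacy`);
`exists_ringKrullDim_eq_and_trdeg_eq`, `ringKrullDim_eq_of_isIntegral`,
`ringKrullDim_quotient_add_one_le` (`Literature/RingTheory/KrullDimension/AffineDimension`).
The vanishing ideal of `Z ⊆ GL n K` is written `MvPolynomial.vanishingIdeal K (glCoordFun '' Z)`
as in `ZariskiGL` / `IdentityComponent` (this is the abbreviation `idealSetGL Z` of
`BigCellOpen.lean`, `idealGL H` of `LieAlgebraGLDimension.lean`, not imported here). Mathlib:
`Ideal.quotientKerEquivRange`, `DoubleQuot.quotQuotEquivQuotOfLE`, `Algebra.IsIntegral.of_finite`,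
`ringKrullDim_eq_of_ringEquiv`, `Submodule.toSubalgebra`, `Submodule.span_mul_span`,
`MvPolynomial.bind₁`, `Matrix.GeneralLinearGroup.map`. Mathlib has no Lang theorem
(`lean search 'lang_map|Lang.s theorem|LangSteinberg'`: only this tree's `LangQuasiSplit`).
No definitions, no instances, no named facts are introduced.

## References

* [SpringerLAG1998] T. A. Springer, *Linear Algebraic Groups*, 2nd ed., Progress in Mathematics 9,
  Birkhäuser (1998): 1.9.5, 2.2.1 (i), 4.4.16–4.4.17 (PDF p. 80–81), 6.2.7 (iii), 16.2.9 (2).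
* [Lang1956] S. Lang, *Algebraic groups over finite fields*, Amer. J. Math. 78 (1956), 555–563.
* [Serre1988] J.-P. Serre, *Algebraic Groups and Class Fields*, GTM 117 (1988), VI §1 no. 4,
  Prop. 3.
* [MalleTesterman2011] G. Malle, D. Testerman, *Linear Algebraic Groups and Finite Groups of Lie
  Type* (2011), Thm. 6.4 (a), Thm. 21.7 (citing Steinberg, *Endomorphisms of linear algebraic
  groups*, Mem. AMS 80 (1968), Thm. 10.1), Thm. 21.11 (a), Cor. 21.12 (PDF pp. 42, 178–180).
* [Borel1991] A. Borel, *Linear Algebraic Groups*, 2nd ed., GTM 126 (1991), 16.6 (as cited in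
  `Sweep2.lean`; not held).
* P. Müller, *Algebraic groups over finite fields, a quick proof of Lang's theorem*, Proc. Amer.
  Math. Soc. 131 (2003), 369–370.
-/

noncomputable section

open scoped MatrixGroups Polynomial

namespace Literature.NumberTheory.Automorphic

/-! ### A finiteness lemma: `q`-power relations that are linear make `C[u]` a finite `C`-module -/

section PowLinear

variable {R A : Type*} [CommRing R] [CommRing A] [Algebra R A] (C : Subalgebra R A)
  {ι : Type*} [Fintype ι] [DecidableEq ι]

/-- Splitting off one factor of a monomial: `∏ u^(m + e_{i₀}) = u_{i₀} · ∏ u^m`. [folklore] -/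
lemma prod_pow_update_succ (u : ι → A) (m : ι → ℕ) (i₀ : ι) :
    ∏ i, u i ^ Function.update m i₀ (m i₀ + 1) i = u i₀ * ∏ i, u i ^ m i := by
  rw [← Finset.mul_prod_erase Finset.univ _ (Finset.mem_univ i₀),
    ← Finset.mul_prod_erase Finset.univ (fun i => u i ^ m i) (Finset.mem_univ i₀)]
  simp only [Function.update_self, pow_succ]
  rw [mul_comm (u i₀ ^ m i₀) (u i₀), mul_assoc]
  congr 2
  exact Finset.prod_congr rfl fun i hi => by
    rw [Function.update_of_ne (Finset.ne_of_mem_erase hi)]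

/-- Splitting off `q` factors: if `q ≤ m i₀` then `∏ u^m = u_{i₀}^q · ∏ u^(m - q e_{i₀})`. [folklore] -/
lemma prod_pow_eq_pow_mul_prod_update_sub (u : ι → A) (m : ι → ℕ) (i₀ : ι) {q : ℕ}
    (hq : q ≤ m i₀) :
    ∏ i, u i ^ m i = u i₀ ^ q * ∏ i, u i ^ Function.update m i₀ (m i₀ - q) i := by
  rw [← Finset.mul_prod_erase Finset.univ _ (Finset.mem_univ i₀),
    ← Finset.mul_prod_erase Finset.univ (fun i => u i ^ Function.update m i₀ (m i₀ - q) i)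
      (Finset.mem_univ i₀)]
  simp only [Function.update_self]
  rw [← mul_assoc, ← pow_add, Nat.add_sub_cancel' hq]
  congr 1
  exact Finset.prod_congr rfl fun i hi => by
    rw [Function.update_of_ne (Finset.ne_of_mem_erase hi)]

/-- **Finiteness from `q`-power relations.** Let `C` be a subalgebra of a commutative algebra
`A`, `u : ι → A` finitely many elements and `q ≥ 2`. If every `u i ^ q` is a `C`-linear combination of the `u j`, then
every monomial in the `u i` is a `C`-linear combination of the monomials with all exponents `< q`
(induction on the total degree: replace `u_{i₀}^q` by a linear form, which lowers the degree by
`q - 1 ≥ 1`). [folklore] -/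
theorem prod_pow_mem_span_of_pow_mem_span (u : ι → A) {q : ℕ} (hq : 2 ≤ q)
    (hu : ∀ i, u i ^ q ∈ Submodule.span C (Set.range u)) (m : ι → ℕ) :
    (∏ i, u i ^ m i) ∈ Submodule.span C
      (Set.range fun m' : ι → Fin q => ∏ i, u i ^ (m' i : ℕ)) := by
  -- strong induction on the total degree
  suffices h : ∀ s : ℕ, ∀ m : ι → ℕ, ∑ i, m i = s → (∏ i, u i ^ m i) ∈ Submodule.span C
      (Set.range fun m' : ι → Fin q => ∏ i, u i ^ (m' i : ℕ)) from h _ m rfl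
  intro s
  induction s using Nat.strong_induction_on with
  | _ s ih =>
    intro m hm
    by_cases hsmall : ∀ i, m i < q
    · exact Submodule.subset_span ⟨fun i => ⟨m i, hsmall i⟩, rfl⟩
    push Not at hsmall
    obtain ⟨i₀, hi₀⟩ := hsmall
    rw [prod_pow_eq_pow_mul_prod_update_sub u m i₀ hi₀]
    set m' := Function.update m i₀ (m i₀ - q) with hm'
    -- the total degree of `m'` is `s - q`
    have hsum' : ∑ i, m' i + q = s := by
      have h1 : ∑ i, m' i = (m i₀ - q) + ∑ i ∈ Finset.univ.erase i₀, m i := by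
        rw [hm', Finset.sum_update_of_mem (Finset.mem_univ i₀), Finset.sdiff_singleton_eq_erase]
      have h2 : m i₀ + ∑ i ∈ Finset.univ.erase i₀, m i = s := by
        rw [Finset.add_sum_erase Finset.univ m (Finset.mem_univ i₀), hm]
      omega
    -- `u i₀ ^ q = ∑ c j • u j`
    obtain ⟨c, hc⟩ := (Submodule.mem_span_range_iff_exists_fun C).1 (hu i₀)
    rw [← hc, Finset.sum_mul]
    refine Submodule.sum_mem _ fun j _ => ?_
    rw [smul_mul_assoc]
    refine Submodule.smul_mem _ _ ?_
    rw [← prod_pow_update_succ u m' j]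
    -- the new total degree is `s - q + 1 < s`
    refine ih (∑ i, Function.update m' j (m' j + 1) i) ?_ _ rfl
    have h3 : ∑ i, Function.update m' j (m' j + 1) i = (m' j + 1) + ∑ i ∈ Finset.univ.erase j, m' i := by
      rw [Finset.sum_update_of_mem (Finset.mem_univ j), Finset.sdiff_singleton_eq_erase]
    have h4 : m' j + ∑ i ∈ Finset.univ.erase j, m' i = ∑ i, m' i :=
      Finset.add_sum_erase Finset.univ m' (Finset.mem_univ j)
    omega

/-- Under the hypotheses of `prod_pow_mem_span_of_pow_mem_span`, if moreover the `u i` generate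
`A` over the subalgebra `C`, then `A` is a finite `C`-module (spanned by the `q ^ #ι` monomials
of exponents `< q`), hence integral over `C`. [folklore] -/
theorem moduleFinite_of_pow_mem_span (u : ι → A) {q : ℕ} (hq : 2 ≤ q)
    (hu : ∀ i, u i ^ q ∈ Submodule.span C (Set.range u))
    (hgen : Algebra.adjoin C (Set.range u) = ⊤) : Module.Finite C A := by
  classical
  set N : Submodule C A := Submodule.span C
    (Set.range fun m' : ι → Fin q => ∏ i, u i ^ (m' i : ℕ)) with hN
  -- all monomials lie in `N`
  have hmono : ∀ m : ι → ℕ, (∏ i, u i ^ m i) ∈ N := prod_pow_mem_span_of_pow_mem_span C u hq hu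
  -- `N` is closed under multiplication and contains `1`
  have hone : (1 : A) ∈ N := by simpa using hmono 0
  have hmul : ∀ a b : A, a ∈ N → b ∈ N → a * b ∈ N := by
    have hNN : N * N ≤ N := by
      rw [hN, Submodule.span_mul_span, Submodule.span_le]
      rintro _ ⟨a, ha, b, hb, rfl⟩
      obtain ⟨m₁, rfl⟩ := ha
      obtain ⟨m₂, rfl⟩ := hb
      change (∏ i, u i ^ (m₁ i : ℕ)) * (∏ i, u i ^ (m₂ i : ℕ)) ∈ N
      have : (∏ i, u i ^ (m₁ i : ℕ)) * ∏ i, u i ^ (m₂ i : ℕ) =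
          ∏ i, u i ^ ((m₁ i : ℕ) + m₂ i) := by
        rw [← Finset.prod_mul_distrib]
        exact Finset.prod_congr rfl fun i _ => (pow_add _ _ _).symm
      rw [this]
      exact hmono _
    intro a b ha hb
    exact hNN (Submodule.mul_mem_mul ha hb)
  -- hence `N` is a subalgebra containing the `u i`, so `N = ⊤`
  have hle : Algebra.adjoin C (Set.range u) ≤ N.toSubalgebra hone hmul := by
    refine Algebra.adjoin_le ?_
    rintro _ ⟨i, rfl⟩
    change u i ∈ N
    have h := prod_pow_update_succ u 0 i ▸ hmono (Function.update 0 i ((0 : ι → ℕ) i + 1))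
    simpa using h
  rw [hgen, top_le_iff] at hle
  have htop : N = ⊤ := eq_top_iff.2 fun a _ =>
    Submodule.mem_toSubalgebra.1 (hle.symm ▸ Algebra.mem_top : a ∈ N.toSubalgebra hone hmul)
  refine Module.finite_def.2 ?_
  rw [← htop, hN]
  exact Submodule.fg_span (Set.finite_range _)

end PowLinear


/-! ### Dominance of polynomial self-maps by integrality -/

section Dominance

variable {K : Type*} [Field K]

/-- **Equal dimension forces equal kernel.** Let `Q` be a prime ideal of `R = K[X_σ]` (`σ`
finite), `θ : R → R ⧸ Q` a `K`-algebra homomorphism killing `Q`, and suppose `R ⧸ Q` is a finite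
module over the image of `θ`. Then `ker θ = Q`. Indeed `R ⧸ Q` is integral over
`im θ ≅ R ⧸ ker θ`, so both have the same (finite) Krull dimension `s` (going up / incomparability,
`ringKrullDim_eq_of_isIntegral`), while for `ker θ ⊋ Q` the quotient `R ⧸ ker θ` of the affine
domain `R ⧸ Q` by a non-zero prime would have dimension `≤ s - 1`. [folklore] -/
theorem ker_eq_of_moduleFinite_range {σ : Type*} [Finite σ] (Q : Ideal (MvPolynomial σ K))
    [Q.IsPrime] (θ : MvPolynomial σ K →ₐ[K] MvPolynomial σ K ⧸ Q) (hQ : Q ≤ RingHom.ker θ)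
    [Module.Finite θ.range (MvPolynomial σ K ⧸ Q)] : RingHom.ker θ = Q := by
  set A := MvPolynomial σ K ⧸ Q with hA
  haveI : IsDomain A := Ideal.Quotient.isDomain Q
  obtain ⟨s, hsA, -⟩ := RingTheory.KrullDimension.exists_ringKrullDim_eq_and_trdeg_eq K A
  haveI : Algebra.IsIntegral θ.range A := Algebra.IsIntegral.of_finite θ.range A
  have hCA : ringKrullDim θ.range = ringKrullDim A :=
    RingTheory.KrullDimension.ringKrullDim_eq_of_isIntegral (R := θ.range) (S := A)
      Subtype.val_injective
  have hC : ringKrullDim (MvPolynomial σ K ⧸ RingHom.ker θ) = ringKrullDim A := by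
    rw [← hCA]
    exact ringKrullDim_eq_of_ringEquiv (Ideal.quotientKerEquivRange θ).toRingEquiv
  by_contra hne
  have hmap : (RingHom.ker θ).map (Ideal.Quotient.mk Q) ≠ ⊥ := by
    rw [Ne, Ideal.map_eq_bot_iff_le_ker, Ideal.mk_ker]
    exact fun h => hne (le_antisymm h hQ)
  have hdim := RingTheory.KrullDimension.ringKrullDim_quotient_add_one_le hmap
  rw [ringKrullDim_eq_of_ringEquiv (DoubleQuot.quotQuotEquivQuotOfLE hQ), hC, hsA] at hdim
  have : s + 1 ≤ s := by exact_mod_cast hdim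
  omega

variable {n : Type*} [Fintype n] [DecidableEq n]

/-- The comorphism of a polynomial self-map `ψ` of `GL n K` with coordinate polynomials `Ψ`
pulls the vanishing ideal of `T` back to the vanishing ideal of `ψ(T)`:
`(Ψ^*)⁻¹ 𝓘(T) = 𝓘(ψ T)` (here `𝓘(Z)` is `MvPolynomial.vanishingIdeal K (glCoordFun '' Z)`, the
`idealSetGL Z` of `BigCellOpen.lean`). [folklore] -/
theorem comap_bind₁_vanishingIdeal {ψ : GL n K → GL n K}
    {Ψ : GLCoord n → MvPolynomial (GLCoord n) K}
    (hΨ : ∀ g c, glCoordFun (ψ g) c = MvPolynomial.eval (glCoordFun g) (Ψ c)) (T : Set (GL n K)) :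
    Ideal.comap (MvPolynomial.bind₁ Ψ).toRingHom
        (MvPolynomial.vanishingIdeal K (glCoordFun '' T)) =
      MvPolynomial.vanishingIdeal K (glCoordFun '' (ψ '' T)) := by
  ext f
  rw [Ideal.mem_comap, mem_vanishingIdeal_glCoordFun_iff, mem_vanishingIdeal_glCoordFun_iff,
    Set.forall_mem_image]
  refine forall₂_congr fun g _ => ?_
  rw [AlgHom.toRingHom_eq_coe, RingHom.coe_coe, eval_bind₁,
    show (fun c => MvPolynomial.eval (glCoordFun g) (Ψ c)) = glCoordFun (ψ g) from
      funext fun c => (hΨ g c).symm]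

/-- **Dominance by integrality.** Let `G ≤ GL n K` be Zariski-connected, `ψ` a polynomial
self-map of `GL n K` (coordinate polynomials `Ψ`) with `ψ(G) ⊆ G`, and `θ = Ψ^* mod 𝓘(G)` the
comorphism `K[X] → K[G] = K[X] ⧸ 𝓘(G)` of `ψ|_G`. If `K[G]` is a finite module over `im θ`
(i.e. `ψ|_G : G → G` is a finite morphism), then `ψ(G)` is dense in `G`: `𝓘(ψ G) = 𝓘(G)`.
[folklore] -/
theorem vanishingIdeal_image_eq_of_moduleFinite {G : Subgroup (GL n K)} (hG : IsZConnected G)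
    {ψ : GL n K → GL n K} {Ψ : GLCoord n → MvPolynomial (GLCoord n) K}
    (hΨ : ∀ g c, glCoordFun (ψ g) c = MvPolynomial.eval (glCoordFun g) (Ψ c))
    (hψG : Set.MapsTo ψ G G)
    (hfin : Module.Finite
      ((Ideal.Quotient.mkₐ K (MvPolynomial.vanishingIdeal K
          (glCoordFun '' (G : Set (GL n K))))).comp (MvPolynomial.bind₁ Ψ)).range
      (MvPolynomial (GLCoord n) K ⧸
        MvPolynomial.vanishingIdeal K (glCoordFun '' (G : Set (GL n K))))) :
    MvPolynomial.vanishingIdeal K (glCoordFun '' (ψ '' (G : Set (GL n K)))) =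
      MvPolynomial.vanishingIdeal K (glCoordFun '' (G : Set (GL n K))) := by
  set Q := MvPolynomial.vanishingIdeal K (glCoordFun '' (G : Set (GL n K))) with hQ
  set θ := (Ideal.Quotient.mkₐ K Q).comp (MvPolynomial.bind₁ Ψ) with hθ
  haveI : Q.IsPrime := hG.isPrime_vanishingIdeal
  have hker : RingHom.ker θ = MvPolynomial.vanishingIdeal K (glCoordFun '' (ψ '' (G : Set (GL n K)))) := by
    rw [← comap_bind₁_vanishingIdeal hΨ]
    ext f
    rw [RingHom.mem_ker, Ideal.mem_comap, hθ, AlgHom.comp_apply, Ideal.Quotient.mkₐ_eq_mk,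
      Ideal.Quotient.eq_zero_iff_mem]
    rfl
  have hQker : Q ≤ RingHom.ker θ := by
    rw [hker]
    exact MvPolynomial.vanishingIdeal_anti_mono (Set.image_mono hψG.image_subset)
  rw [← hker]
  exact ker_eq_of_moduleFinite_range Q θ hQker

end Dominance


/-! ### The Lang maps `g ↦ g⁻¹ x F(g)` are finite morphisms -/

section LangMap

variable {k K : Type*} [Field k] [Field K] [Algebra k K] [Finite k]
variable {n : Type*} [Fintype n] [DecidableEq n]

/-- The Frobenius `F = frobGL k K n`, `(g_{ij}) ↦ (g_{ij}^q)`, is a polynomial self-map of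
`GL n K` with coordinate polynomials `X_c ^ q` (also for the coordinate `det⁻¹`). [folklore] -/
theorem isPolyMapGL_frobGL : IsPolyMapGL (frobGL k K n) :=
  ⟨fun c => MvPolynomial.X c ^ Nat.card k, fun g c => by
    rw [map_pow, MvPolynomial.eval_X]
    change glCoordFun (Matrix.GeneralLinearGroup.map (qFrobenius k K) g) c = _
    rw [glCoordFun_map, qFrobenius_apply]⟩

/-- The (twisted) **Lang map** `g ↦ g⁻¹ x F(g)` is a polynomial self-map of `GL n K`. [folklore] -/
theorem isPolyMapGL_langMap (x : GL n K) : IsPolyMapGL fun g : GL n K => g⁻¹ * x * frobGL k K n g :=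
  ((isPolyMapGL_id.inv).mul (isPolyMapGL_const x)).mul isPolyMapGL_frobGL

/-- The basic identity behind Lang's theorem: `x⁻¹ · g · (g⁻¹ x F g) = F g`. [folklore] -/
lemma inv_mul_mul_langMap (x g : GL n K) : x⁻¹ * g * (g⁻¹ * x * frobGL k K n g) = frobGL k K n g := by
  group

/-- Entries of `F g` as entries of the product `x⁻¹ g ψ(g)`, `ψ` the Lang map:
`g_{ij}^q = ∑_{a,l} (x⁻¹)_{ia} g_{al} ψ(g)_{lj}`. [folklore] -/
lemma pow_card_entry_eq_sum (x g : GL n K) (i j : n) :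
    ((g : Matrix n n K) i j) ^ Nat.card k =
      ∑ a, ∑ l, ((x⁻¹ : GL n K) : Matrix n n K) i a * (g : Matrix n n K) a l *
        ((g⁻¹ * x * frobGL k K n g : GL n K) : Matrix n n K) l j := by
  have h2 : ((frobGL k K n g : GL n K) : Matrix n n K) i j =
      ((x⁻¹ * g * (g⁻¹ * x * frobGL k K n g) : GL n K) : Matrix n n K) i j := by
    rw [inv_mul_mul_langMap]
  rw [← frobGL_apply_apply, h2, Units.val_mul, Units.val_mul, Matrix.mul_apply]
  simp only [Matrix.mul_apply, Finset.sum_mul]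
  rw [Finset.sum_comm]

/-- The determinant of `F g` is `(det g) ^ q`. [folklore] -/
lemma det_frobGL (g : GL n K) :
    Matrix.det ((frobGL k K n g : GL n K) : Matrix n n K) = (Matrix.det (g : Matrix n n K)) ^ Nat.card k := by
  change Matrix.det ((qFrobenius k K).mapMatrix (g : Matrix n n K)) = _
  rw [← RingHom.map_det, qFrobenius_apply]

/-- The coordinate `det⁻¹` of `F g` through the product `x⁻¹ g ψ(g)`:
`(det g)⁻¹ ^ q = det x · (det g)⁻¹ · (det ψ(g))⁻¹`. [folklore] -/
lemma inv_det_pow_card_eq (x g : GL n K) :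
    ((Matrix.det (g : Matrix n n K))⁻¹) ^ Nat.card k =
      Matrix.det (x : Matrix n n K) * (Matrix.det (g : Matrix n n K))⁻¹ *
        (Matrix.det ((g⁻¹ * x * frobGL k K n g : GL n K) : Matrix n n K))⁻¹ := by
  have h2 : Matrix.det ((frobGL k K n g : GL n K) : Matrix n n K) =
      Matrix.det ((x⁻¹ * g * (g⁻¹ * x * frobGL k K n g) : GL n K) : Matrix n n K) := by
    rw [inv_mul_mul_langMap]
  rw [inv_pow, ← det_frobGL, h2, Units.val_mul, Units.val_mul, Matrix.det_mul, Matrix.det_mul,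
    Matrix.coe_units_inv, Matrix.det_nonsing_inv, mul_inv, mul_inv, Ring.inverse_eq_inv', inv_inv]

attribute [local instance] zariskiTopologyGL zariskiTopologyPi

/-- **The Lang map is a finite morphism.** For any `T ⊆ GL n K` mapped into itself by the Lang
map `ψ(g) = g⁻¹ x F(g)` (coordinate polynomials `Ψ`), the coordinate ring
`K[T] = K[X] ⧸ 𝓘(T)` is a finite module over the image of the comorphism `θ = Ψ^* mod 𝓘(T)`:
indeed from `F(g) = x⁻¹ g ψ(g)` every coordinate function `u_c` satisfies `u_c ^ q = ∑ M_{cc'} u_{c'}`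
with `M_{cc'} ∈ im θ`, so the `q ^ (n² + 1)` monomials of exponents `< q` span `K[T]` over `im θ`
(`moduleFinite_of_pow_mem_span`). This finiteness of the Lang map replaces the tangent-space
computation `dΛ = -1` of Springer 4.4.17 (compare Lang 1956 and P. Müller, *Proc. AMS* 131
(2003), for differential-free arguments). [folklore] -/
theorem moduleFinite_range_comorph_langMap (x : GL n K) (T : Set (GL n K))
    {Ψ : GLCoord n → MvPolynomial (GLCoord n) K}
    (hΨ : ∀ g c, glCoordFun (g⁻¹ * x * frobGL k K n g) c = MvPolynomial.eval (glCoordFun g) (Ψ c)) :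
    Module.Finite
      ((Ideal.Quotient.mkₐ K (MvPolynomial.vanishingIdeal K (glCoordFun '' T))).comp
          (MvPolynomial.bind₁ Ψ)).range
      (MvPolynomial (GLCoord n) K ⧸ MvPolynomial.vanishingIdeal K (glCoordFun '' T)) := by
  classical
  set Q := MvPolynomial.vanishingIdeal K (glCoordFun '' T) with hQ
  set θ := (Ideal.Quotient.mkₐ K Q).comp (MvPolynomial.bind₁ Ψ) with hθ
  set u : GLCoord n → MvPolynomial (GLCoord n) K ⧸ Q := fun c => Ideal.Quotient.mk Q (MvPolynomial.X c)
    with hu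
  have hq : 2 ≤ Nat.card k := Finite.one_lt_card
  -- `θ (C a * X c) = mk (C a * Ψ c)` lies in the range of `θ`
  have hθCX : ∀ (a : K) (c : GLCoord n),
      Ideal.Quotient.mk Q (MvPolynomial.C a * Ψ c) = θ (MvPolynomial.C a * MvPolynomial.X c) := by
    intro a c
    rw [hθ, AlgHom.comp_apply, Ideal.Quotient.mkₐ_eq_mk]
    simp only [map_mul, MvPolynomial.bind₁_C_right, MvPolynomial.bind₁_X_right]
  -- two polynomials with the same values on `T` agree in `K[T]`
  have hmk : ∀ p p' : MvPolynomial (GLCoord n) K,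
      (∀ g ∈ T, MvPolynomial.eval (glCoordFun g) p = MvPolynomial.eval (glCoordFun g) p') →
      Ideal.Quotient.mk Q p = Ideal.Quotient.mk Q p' := by
    intro p p' h
    rw [Ideal.Quotient.eq, hQ, mem_vanishingIdeal_glCoordFun_iff]
    intro g hg
    rw [map_sub, h g hg, sub_self]
  -- the `q`-power relations
  have hpow : ∀ c, u c ^ Nat.card k ∈ Submodule.span θ.range (Set.range u) := by
    rintro (⟨i, j⟩ | v)
    · -- entries
      have hrel : u (Sum.inl (i, j)) ^ Nat.card k =
          ∑ a, ∑ l, Ideal.Quotient.mk Q (MvPolynomial.C (((x⁻¹ : GL n K) : Matrix n n K) i a) *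
            Ψ (Sum.inl (l, j))) * u (Sum.inl (a, l)) := by
        simp only [hu, ← map_pow, ← map_mul, ← map_sum]
        apply hmk
        intro g _
        simp only [map_pow, MvPolynomial.eval_X, glCoordFun_inl, map_sum, map_mul,
          MvPolynomial.eval_C, ← hΨ]
        rw [pow_card_entry_eq_sum x g i j]
        refine Finset.sum_congr rfl fun a _ => Finset.sum_congr rfl fun l _ => ?_
        ring
      rw [hrel]
      refine Submodule.sum_mem _ fun a _ => Submodule.sum_mem _ fun l _ => ?_
      rw [hθCX]
      exact Submodule.smul_mem _ (⟨θ _, AlgHom.mem_range_self θ _⟩ : θ.range)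
        (Submodule.subset_span ⟨Sum.inl (a, l), rfl⟩)
    · -- `det⁻¹`
      have hrel : u (Sum.inr v) ^ Nat.card k =
          Ideal.Quotient.mk Q (MvPolynomial.C (Matrix.det (x : Matrix n n K)) * Ψ (Sum.inr v)) *
            u (Sum.inr v) := by
        simp only [hu, ← map_pow, ← map_mul]
        apply hmk
        intro g _
        simp only [map_pow, MvPolynomial.eval_X, glCoordFun_inr, map_mul, MvPolynomial.eval_C, ← hΨ]
        rw [inv_det_pow_card_eq x g]
        ring
      rw [hrel, hθCX]
      exact Submodule.smul_mem _ (⟨θ _, AlgHom.mem_range_self θ _⟩ : θ.range)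
        (Submodule.subset_span ⟨Sum.inr v, rfl⟩)
  -- the coordinate functions generate `K[T]`
  have hgen : Algebra.adjoin θ.range (Set.range u) = ⊤ := by
    rw [eq_top_iff]
    rintro a -
    obtain ⟨p, rfl⟩ := Ideal.Quotient.mk_surjective a
    induction p using MvPolynomial.induction_on with
    | C a =>
      rw [← MvPolynomial.algebraMap_eq, Ideal.Quotient.mk_algebraMap]
      exact Subalgebra.algebraMap_mem (Algebra.adjoin θ.range (Set.range u))
        (algebraMap K θ.range a)
    | add p q hp hq => rw [map_add]; exact Subalgebra.add_mem _ hp hq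
    | mul_X p c hp =>
      rw [map_mul]
      exact Subalgebra.mul_mem _ hp (Algebra.subset_adjoin ⟨c, rfl⟩)
  exact moduleFinite_of_pow_mem_span θ.range u hq hpow hgen

end LangMap


/-! ### Lang's theorem -/

section Lang

variable {k K : Type*} [Field k] [Field K] [Algebra k K] [Finite k]
variable {n : Type*} [Fintype n] [DecidableEq n]

attribute [local instance] zariskiTopologyGL zariskiTopologyPi

/-- **The Lang maps have dense open image pieces.** For `G ≤ GL n K` Zariski-connected and
`F`-stable (`K ⊇ k` algebraically closed) and `x ∈ G`, the image of `G` under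
`ψ(g) = g⁻¹ x F(g)` contains a non-empty open subset of `G`: `ψ|_G` is a finite morphism
(`moduleFinite_range_comorph_langMap`), hence dominant (`vanishingIdeal_image_eq_of_moduleFinite`),
and Chevalley's theorem (`exists_isOpen_inter_closure_image_subset_of_isIrreducible`, Springer
1.9.5) applies. [folklore] -/
theorem exists_isOpen_inter_subset_image_langMap [IsAlgClosed K] {G : Subgroup (GL n K)}
    (hG : IsZConnected G) (hFG : G.map (frobGL k K n) = G) {x : GL n K} (hx : x ∈ G) :
    ∃ W : Set (GL n K), IsOpen W ∧ (W ∩ (G : Set (GL n K))).Nonempty ∧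
      W ∩ (G : Set (GL n K)) ⊆ (fun g : GL n K => g⁻¹ * x * frobGL k K n g) '' (G : Set (GL n K)) := by
  set ψ : GL n K → GL n K := fun g => g⁻¹ * x * frobGL k K n g with hψdef
  obtain ⟨Ψ, hΨ⟩ := isPolyMapGL_langMap (k := k) (K := K) (n := n) x
  have hFmem : ∀ g ∈ G, frobGL k K n g ∈ G := fun g hg => by
    rw [← hFG]; exact Subgroup.mem_map_of_mem _ hg
  have hψG : Set.MapsTo ψ (G : Set (GL n K)) (G : Set (GL n K)) := fun g hg =>
    G.mul_mem (G.mul_mem (G.inv_mem hg) hx) (hFmem g hg)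
  -- dominance
  have hI := vanishingIdeal_image_eq_of_moduleFinite hG hΨ hψG
    (moduleFinite_range_comorph_langMap x (G : Set (GL n K)) hΨ)
  -- closure of the image is `G`
  have hcl : closure (ψ '' (G : Set (GL n K))) = G := by
    refine Set.Subset.antisymm (closure_minimal hψG.image_subset hG.1.isClosed) fun g hg => ?_
    obtain ⟨S, hS⟩ := isClosed_zariski_iff.1 (isClosed_closure (s := ψ '' (G : Set (GL n K))))
    rw [hS]
    intro s hs
    have hsI : s ∈ MvPolynomial.vanishingIdeal K (glCoordFun '' (ψ '' (G : Set (GL n K)))) := by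
      refine mem_vanishingIdeal_glCoordFun_iff.2 fun y hy => ?_
      have hy' : y ∈ closure (ψ '' (G : Set (GL n K))) := subset_closure hy
      rw [hS] at hy'
      exact hy' s hs
    rw [hI] at hsI
    exact mem_vanishingIdeal_glCoordFun_iff.1 hsI g hg
  -- Chevalley in coordinates
  have hcemb := isClosedEmbedding_glCoordFun (n := n) (k := K)
  set V : Set (GLCoord n → K) := glCoordFun '' (G : Set (GL n K)) with hV
  have hVcl : IsClosed V := hcemb.isClosedMap _ hG.1.isClosed
  have hVirr : IsIrreducible V := isIrreducible_image_glCoordFun hG.isIrreducible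
  set φ : (GLCoord n → K) → (GLCoord n → K) := fun v c => MvPolynomial.eval v (Ψ c) with hφ
  have himg : φ '' V = glCoordFun '' (ψ '' (G : Set (GL n K))) := by
    rw [hV, Set.image_image, Set.image_image]
    exact Set.image_congr fun g _ => funext fun c => (hΨ g c).symm
  obtain ⟨W', hW', hW'ne, hW'sub⟩ :=
    exists_isOpen_inter_closure_image_subset_of_isIrreducible hVcl.isLocallyClosed hVirr Ψ
      (φ := φ) (fun _ _ => rfl)
  rw [himg, hcemb.closure_image_eq, hcl] at hW'ne hW'sub
  refine ⟨glCoordFun ⁻¹' W', hW'.preimage continuous_glCoordFun, ?_, ?_⟩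
  · obtain ⟨_, hwW, ⟨r, hr, rfl⟩⟩ := hW'ne
    exact ⟨r, hwW, hr⟩
  · rintro r ⟨hrW, hrG⟩
    obtain ⟨r', hr', hrr'⟩ := hW'sub ⟨hrW, ⟨r, hrG, rfl⟩⟩
    rw [← glCoordFun_injective hrr']
    exact hr'

/-- **Lang's theorem for `F`-stable connected subgroups** (Springer 4.4.17 and its proof, PDF
p. 81; Steinberg 1968, Thm. 10.1; Malle–Testerman Thm. 21.7): if `G ≤ GL n K` (`K ⊇ k = 𝔽_q`
algebraically closed) is Zariski-connected and stable under the `q`-Frobenius `F`, then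
`g ↦ g⁻¹ F(g)` maps `G` onto `G`. Proof as printed in Springer: for `x ∈ G` the images of `G`
under `g ↦ g⁻¹ F(g)` and `g ↦ g⁻¹ x F(g)` both contain non-empty open subsets of the irreducible
`G` (`exists_isOpen_inter_subset_image_langMap`), which meet: `a⁻¹ F(a) = b⁻¹ x F(b)` gives
`x = (a b⁻¹)⁻¹ F(a b⁻¹)`. [cite: SpringerLAG1998, Thm. 4.4.17 (proof)] -/
theorem exists_inv_mul_frobGL_eq [IsAlgClosed K] {G : Subgroup (GL n K)} (hG : IsZConnected G)
    (hFG : G.map (frobGL k K n) = G) {x : GL n K} (hx : x ∈ G) :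
    ∃ g ∈ G, g⁻¹ * frobGL k K n g = x := by
  obtain ⟨W₁, hW₁, hW₁ne, hW₁sub⟩ := exists_isOpen_inter_subset_image_langMap hG hFG G.one_mem
  obtain ⟨W₂, hW₂, hW₂ne, hW₂sub⟩ := exists_isOpen_inter_subset_image_langMap hG hFG hx
  obtain ⟨g₀, hg₀G, hg₀W₁, hg₀W₂⟩ := (hG.isIrreducible).isPreirreducible W₁ W₂ hW₁ hW₂
    (by obtain ⟨g, hgW, hgG⟩ := hW₁ne; exact ⟨g, hgG, hgW⟩)
    (by obtain ⟨g, hgW, hgG⟩ := hW₂ne; exact ⟨g, hgG, hgW⟩)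
  obtain ⟨a, haG, ha⟩ := hW₁sub ⟨hg₀W₁, hg₀G⟩
  obtain ⟨b, hbG, hb⟩ := hW₂sub ⟨hg₀W₂, hg₀G⟩
  refine ⟨a * b⁻¹, G.mul_mem haG (G.inv_mem hbG), ?_⟩
  simp only [mul_one] at ha hb
  rw [map_mul, map_inv, mul_inv_rev, inv_inv]
  -- from `a⁻¹ * F a = b⁻¹ * x * F b`
  have h : a⁻¹ * frobGL k K n a = b⁻¹ * x * frobGL k K n b := by rw [hb, ha]
  calc b * a⁻¹ * (frobGL k K n a * (frobGL k K n b)⁻¹)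
      = b * (a⁻¹ * frobGL k K n a) * (frobGL k K n b)⁻¹ := by group
    _ = b * (b⁻¹ * x * frobGL k K n b) * (frobGL k K n b)⁻¹ := by rw [h]
    _ = x := by group

omit [Finite k] in
variable (k K n) in
/-- **Lang's theorem** — discharge of the named fact `lang_map_surjective` of
`LangQuasiSplit.lean` (Springer, *Linear Algebraic Groups*, 2nd ed., Thm. 4.4.17 [Lang's theorem],
PDF p. 81, stated there for `K = 𝔽̄_q`; Lang, *Amer. J. Math.* 78 (1956); Serre, *Algebraic Groups
and Class Fields*, VI §1 no. 4, Prop. 3, the form `x ↦ x⁻¹Fx` of the fact; Steinberg 1968,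
Thm. 10.1 = Malle–Testerman Thm. 21.7 for a standard Frobenius map): for `k` finite, `K ⊇ k` algebraically closed and `G ≤ GL n K` Zariski-connected,
closed and defined over `k`, every `x ∈ G` is `g⁻¹ F(g)` for some `g ∈ G`, `F = frobGL k K n` the
`q`-Frobenius. `F(G) = G` by `map_frobGL_eq_of_isDefinedOver`; then `exists_inv_mul_frobGL_eq`.
[cite: SpringerLAG1998, Thm. 4.4.17] -/
theorem lang_map_surjective_holds : lang_map_surjective k K n := by
  intro _ _ G hG hGk x hx
  exact exists_inv_mul_frobGL_eq hG (map_frobGL_eq_of_isDefinedOver hG.1 hGk) hx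

omit [Finite k] in
/-- **Lang's theorem on Borel subgroups, modulo conjugacy**: with Lang's theorem proved
(`lang_map_surjective_holds`) and the existence of Borel subgroups proved
(`isQuasiSplitOver_self_holds`), the named fact `isQuasiSplitOver_of_finite` (a connected
`k`-group over a finite field `k` has a Borel subgroup defined over `k`; Lang 1956, Borel 16.6)
follows from the conjugacy of Borel subgroups alone (`isBorelIn_conj`, Springer 6.2.7 (iii)),
by `isQuasiSplitOver_of_finite_of_facts`. [folklore] -/
theorem isQuasiSplitOver_of_finite_of_isBorelIn_conj (hconj : isBorelIn_conj (k := K) (n := n)) :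
    isQuasiSplitOver_of_finite k K n := by
  intro _ _ G hG hGk
  exact isQuasiSplitOver_of_facts (@isQuasiSplitOver_self_holds K _ n _ _) @hconj
    (@lang_map_surjective_holds k K _ _ _ n _ _) hG hGk

omit [Finite k] in
variable (k K n) in
/-- **Lang's theorem on Borel subgroups over finite fields** — discharge of the named fact
`isQuasiSplitOver_of_finite` of `Sweep2.lean` (**lang.S12**; Lang, *Amer. J. Math.* 78 (1956);
Borel, *Linear Algebraic Groups*, 16.6; Springer 16.2.9 (2): *"Assume that `F` is finite. Then `G`
is quasi-split. (Hint: use Lang's theorem 4.4.17)"*; Malle–Testerman Thm. 21.11 (a) with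
Cor. 21.12: *"there exists … an `F`-stable Borel subgroup"*): for `k` finite and `K ⊇ k`
algebraically closed, every Zariski-connected closed subgroup `G ≤ GL n K` defined over `k`
contains a Borel subgroup defined over `k`. All three inputs of the reduction
`isQuasiSplitOver_of_finite_of_facts` (`LangQuasiSplit.lean`: Lang's construction of an `F`-stable
conjugate of a Borel subgroup and Frobenius descent) are now theorems: existence of Borel
subgroups (`isQuasiSplitOver_self_holds`, `Sweep2Proofs.lean`), their conjugacy
(`isBorelIn_conj_holds`, `BorelConjugacy.lean`, Springer 6.2.7 (iii)) and Lang's theorem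
(`lang_map_surjective_holds` above). [cite: MalleTesterman2011, Thm. 21.11 (a) with Cor. 21.12] -/
theorem isQuasiSplitOver_of_finite_holds : isQuasiSplitOver_of_finite k K n := by
  intro _ _ G hG hGk
  exact isQuasiSplitOver_of_finite_of_isBorelIn_conj (@isBorelIn_conj_holds K _ n _ _) hG hGk

end Lang

end Literature.NumberTheory.Automorphic
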